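import Summits.CriticalPhenomena.PercolationContinuityZ3.Theorems.PercNearOneGluingAdditiveGluingGoodBase
import Summits.CriticalPhenomena.PercolationContinuityZ3.Theorems.PercNearOneGluingAdditiveGluingLemma5AnyRelay
import Summits.CriticalPhenomena.PercolationContinuityZ3.Theorems.PercNearOneGluingAdditiveGluingGluePushforward
import Summits.CriticalPhenomena.PercolationContinuityZ3.Theorems.AdditiveGluing.Negative.EdgeDeletion
import HarnessLib

/-! # Crux `PercNearOneGluing.AdditiveGluing` (stmt-CriticalPhenomena-4576), line `subuniform-dead-pocket-maximum` —
# one-bond calculus for the good-quadruple functional (siege attempt k8, part 1 of 2)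

Helper file (lands `--supports stmt-CriticalPhenomena-4576`).  For the product measure
`μ_w = prodBernoulli w` on bond configurations of the complete graph on `Fin n` and a pair
`e = s(o, y)`, `o ≠ y`:
* `goodStep_real_update_one`: `μ_{w[e↦1]}(S) = μ_w {ω | ω ∪ {e} ∈ S}` (the glue pushforward
  `stub_gluePushforward` for the block `{o, y}`);
* `goodStep_real_inter_open_eq`: `μ_w(S ∩ {e open}) = (w e) · μ_{w[e↦1]}(S)`;
* `goodStep_real_decomp`: `μ_w(S) = (1 − w e) · μ_{w[e↦0]}(S) + (w e) · μ_{w[e↦1]}(S)` — every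
  probability is affine in one weight (closed side: `real_inter_closed_eq`, Negative/EdgeDeletion);
* `goodStep_real_update_eq_of_invariant`: events invariant under toggling `e` have the same
  probability under `w`, `w[e↦0]`, `w[e↦1]`;
* `goodStep_openConnIn_toggle`: `{u ↔ b in Wᶜ}` with `o ∈ W` is such an event.
Part 2 (`…GoodStepOfGlueStep.lean`) uses these to reduce `stub_goodStep` to a one-pair gluing step.
No new definitions.
-/

namespace Summit.CriticalPhenomena.PercolationContinuityZ3.Theorems

open MeasureTheory Set
open Literature.Probability.LatticeModels (prodBernoulli)
open Literature.Probability.Percolation (BondConfig openConn openConnIn openGraph openCluster openGraph_adj)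
open scoped BigOperators

noncomputable section
open Classical

variable {n : ℕ}

/-- The non-loop pairs inside `{o, y}` are exactly the pair `s(o, y)` (`o ≠ y`). [folklore] -/
theorem goodStep_pair_iff {o y : Fin n} (hoy : o ≠ y) (e : Sym2 (Fin n)) :
    ((∀ v ∈ e, v ∈ ({o, y} : Finset (Fin n))) ∧ ¬ e.IsDiag) ↔ e = s(o, y) := by
  induction e using Sym2.ind with
  | h u v =>
    simp only [Sym2.mem_iff, forall_eq_or_imp, forall_eq, Finset.mem_insert, Finset.mem_singleton,
      Sym2.mk_isDiag_iff, Sym2.eq, Sym2.rel_iff']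
    constructor
    · rintro ⟨⟨hu | hu, hv | hv⟩, huv⟩ <;> subst hu <;> subst hv <;> simp_all
    · rintro (⟨rfl, rfl⟩ | ⟨rfl, rfl⟩)
      · exact ⟨⟨Or.inl rfl, Or.inr rfl⟩, hoy⟩
      · exact ⟨⟨Or.inr rfl, Or.inl rfl⟩, fun h => hoy h.symm⟩

/-- **Opening one pair**: `μ_{w[e ↦ 1]}(S) = μ_w {ω | ω ∪ {e} ∈ S}` for `e = s(o, y)`, `o ≠ y`
(the glue pushforward `stub_gluePushforward` for the two-point block `{o, y}`). [folklore] -/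
theorem goodStep_real_update_one (w : Sym2 (Fin n) → unitInterval) {o y : Fin n} (hoy : o ≠ y)
    (S : Set (BondConfig (Fin n))) :
    (prodBernoulli (Function.update w s(o, y) 1)).real S =
      (prodBernoulli w).real {ω : BondConfig (Fin n) | ω ∪ {s(o, y)} ∈ S} := by
  have h := stub_gluePushforward n w ({o, y} : Finset (Fin n)) S
  have hw : (fun e : Sym2 (Fin n) =>
      if (∀ x ∈ e, x ∈ ({o, y} : Finset (Fin n))) ∧ ¬ e.IsDiag then (1 : unitInterval) else w e) =
      Function.update w s(o, y) 1 := by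
    funext e
    by_cases he : e = s(o, y)
    · rw [if_pos ((goodStep_pair_iff hoy e).2 he), he, Function.update_self]
    · rw [if_neg (fun h' => he ((goodStep_pair_iff hoy e).1 h')), Function.update_of_ne he]
  have hset : {e : Sym2 (Fin n) | (∀ x ∈ e, x ∈ ({o, y} : Finset (Fin n))) ∧ ¬ e.IsDiag} = {s(o, y)} := by
    ext e
    rw [Set.mem_setOf_eq, Set.mem_singleton_iff]
    exact goodStep_pair_iff hoy e
  rw [hw, hset] at h
  exact h

/-- **One-bond decomposition on the open side**: `μ_w(S ∩ {e open}) = (w e) · μ_{w[e ↦ 1]}(S)` for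
`e = s(o, y)`, `o ≠ y`. [folklore] -/
theorem goodStep_real_inter_open_eq (w : Sym2 (Fin n) → unitInterval) {o y : Fin n} (hoy : o ≠ y)
    (S : Set (BondConfig (Fin n))) :
    (prodBernoulli w).real (S ∩ {ω | s(o, y) ∈ ω}) =
      (w s(o, y) : ℝ) * (prodBernoulli (Function.update w s(o, y) 1)).real S := by
  set e : Sym2 (Fin n) := s(o, y) with he
  set T : Set (BondConfig (Fin n)) := {ω | ω ∪ {e} ∈ S} with hT
  have hTm : MeasurableSet T := (Set.toFinite T).measurableSet
  -- split `μ_w(T)` along `{e open} ⊔ {e closed}`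
  have hsplit : (prodBernoulli w).real T =
      (prodBernoulli w).real (T ∩ {ω | e ∈ ω}) + (prodBernoulli w).real (T ∩ {ω | e ∉ ω}) := by
    have hU : T = (T ∩ {ω | e ∈ ω}) ∪ (T ∩ {ω | e ∉ ω}) := by
      ext ω; simp only [mem_union, mem_inter_iff, mem_setOf_eq]; tauto
    have hD : Disjoint (T ∩ {ω | e ∈ ω}) (T ∩ {ω | e ∉ ω}) := by
      rw [Set.disjoint_left]
      rintro ω ⟨-, h1⟩ ⟨-, h2⟩
      exact h2 h1
    conv_lhs => rw [hU]
    exact measureReal_union hD ((Set.toFinite _).measurableSet)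
  -- on `{e open}`, `ω ∪ {e} = ω`
  have hopen : T ∩ {ω | e ∈ ω} = S ∩ {ω | e ∈ ω} := by
    ext ω
    simp only [hT, mem_inter_iff, mem_setOf_eq]
    constructor
    · rintro ⟨h1, h2⟩
      have : ω ∪ {e} = ω := Set.union_eq_self_of_subset_right (Set.singleton_subset_iff.2 h2)
      exact ⟨this ▸ h1, h2⟩
    · rintro ⟨h1, h2⟩
      have : ω ∪ {e} = ω := Set.union_eq_self_of_subset_right (Set.singleton_subset_iff.2 h2)
      exact ⟨this.symm ▸ h1, h2⟩
  -- on `{e closed}`, the deleted-edge law, and `w[e↦0][e↦1] = w[e↦1]`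
  have hclosed : (prodBernoulli w).real (T ∩ {ω | e ∉ ω}) =
      (1 - (w e : ℝ)) * (prodBernoulli (Function.update w e 1)).real S := by
    rw [AdditiveGluing.Negative.real_inter_closed_eq w e hTm, he]
    congr 1
    rw [← Function.update_idem (f := w) (a := s(o, y)) 0 1,
      goodStep_real_update_one (Function.update w s(o, y) 0) hoy S]
  have h1 : (prodBernoulli (Function.update w e 1)).real S = (prodBernoulli w).real T := by
    rw [he, goodStep_real_update_one w hoy S]
  rw [← hopen]
  have := hsplit
  rw [hclosed, ← h1] at this
  linarith

/-- **One-bond decomposition**: `μ_w(S) = (1 − w e) · μ_{w[e↦0]}(S) + (w e) · μ_{w[e↦1]}(S)` for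
`e = s(o, y)`, `o ≠ y` — every `μ_w`-probability is affine in the weight of one pair. [folklore] -/
theorem goodStep_real_decomp (w : Sym2 (Fin n) → unitInterval) {o y : Fin n} (hoy : o ≠ y)
    (S : Set (BondConfig (Fin n))) :
    (prodBernoulli w).real S =
      (1 - (w s(o, y) : ℝ)) * (prodBernoulli (Function.update w s(o, y) 0)).real S +
        (w s(o, y) : ℝ) * (prodBernoulli (Function.update w s(o, y) 1)).real S := by
  have hSm : MeasurableSet S := (Set.toFinite S).measurableSet
  have hU : S = (S ∩ {ω | s(o, y) ∉ ω}) ∪ (S ∩ {ω | s(o, y) ∈ ω}) := by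
    ext ω; simp only [mem_union, mem_inter_iff, mem_setOf_eq]; tauto
  have hD : Disjoint (S ∩ {ω | s(o, y) ∉ ω}) (S ∩ {ω | s(o, y) ∈ ω}) := by
    rw [Set.disjoint_left]
    rintro ω ⟨-, h1⟩ ⟨-, h2⟩
    exact h1 h2
  conv_lhs => rw [hU]
  rw [measureReal_union hD ((Set.toFinite _).measurableSet),
    AdditiveGluing.Negative.real_inter_closed_eq w _ hSm, goodStep_real_inter_open_eq w hoy S]

/-- **Invariance**: if toggling the pair `e = s(o, y)` never changes membership in `S`, then
`μ_{w[e↦1]}(S) = μ_w(S)` and `μ_{w[e↦0]}(S) = μ_w(S)`. [folklore] -/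
theorem goodStep_real_update_eq_of_invariant (w : Sym2 (Fin n) → unitInterval) {o y : Fin n}
    (hoy : o ≠ y) (S : Set (BondConfig (Fin n)))
    (hS1 : ∀ ω : BondConfig (Fin n), ω ∪ {s(o, y)} ∈ S ↔ ω ∈ S)
    (hS0 : ∀ ω : BondConfig (Fin n), ω \ {s(o, y)} ∈ S ↔ ω ∈ S) :
    (prodBernoulli (Function.update w s(o, y) 1)).real S = (prodBernoulli w).real S ∧
      (prodBernoulli (Function.update w s(o, y) 0)).real S = (prodBernoulli w).real S := by
  constructor
  · rw [goodStep_real_update_one w hoy S]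
    congr 1
    ext ω
    exact hS1 ω
  · have hmeas : Measurable fun ω : BondConfig (Fin n) => ω \ {s(o, y)} :=
      Literature.Probability.Percolation.StarTriangle.measurable_sdiff_const _
    rw [← Literature.Probability.Percolation.StarTriangle.prodBernoulli_map_sdiff_singleton w s(o, y),
      map_measureReal_apply hmeas (Set.toFinite S).measurableSet]
    congr 1
    ext ω
    exact hS0 ω

/-- Configurations that agree on the pairs inside `S` induce the same open graph on `S`. [folklore] -/
theorem goodStep_induce_eq {S : Set (Fin n)} {ω ω' : BondConfig (Fin n)}
    (h : ∀ u v : Fin n, u ∈ S → v ∈ S → (s(u, v) ∈ ω ↔ s(u, v) ∈ ω')) :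
    (openGraph ω).induce S = (openGraph ω').induce S := by
  ext ⟨u, hu⟩ ⟨v, hv⟩
  simp only [SimpleGraph.comap_adj, Function.Embedding.coe_subtype, openGraph_adj]
  rw [h u v hu hv]

/-- **Toggling a pair at `o` is invisible off `W ∋ o`**: for `o ∈ W`, membership in
`{u ↔ b in Wᶜ}` is unchanged by opening or closing `s(o, y)`. [folklore] -/
theorem goodStep_openConnIn_toggle {W : Set (Fin n)} {o : Fin n} (ho : o ∈ W) (y u b : Fin n)
    (ω : BondConfig (Fin n)) :
    (ω ∪ {s(o, y)} ∈ openConnIn Wᶜ u b ↔ ω ∈ openConnIn Wᶜ u b) ∧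
      (ω \ {s(o, y)} ∈ openConnIn Wᶜ u b ↔ ω ∈ openConnIn Wᶜ u b) := by
  have hne : ∀ u' v' : Fin n, u' ∈ Wᶜ → v' ∈ Wᶜ → s(u', v') ≠ s(o, y) := by
    intro u' v' hu' hv' h'
    have : o ∈ s(u', v') := by rw [h']; exact Sym2.mem_mk_left o y
    rcases Sym2.mem_iff.1 this with h1 | h1
    · exact hu' (h1 ▸ ho)
    · exact hv' (h1 ▸ ho)
  have h1 : (openGraph (ω ∪ {s(o, y)})).induce Wᶜ = (openGraph ω).induce Wᶜ :=
    goodStep_induce_eq fun u' v' hu' hv' => by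
      simp only [Set.mem_union, Set.mem_singleton_iff, or_iff_left (hne u' v' hu' hv')]
  have h0 : (openGraph (ω \ {s(o, y)})).induce Wᶜ = (openGraph ω).induce Wᶜ :=
    goodStep_induce_eq fun u' v' hu' hv' => by
      simp only [Set.mem_sdiff, Set.mem_singleton_iff, hne u' v' hu' hv', not_false_eq_true, and_true]
  simp only [openConnIn, Set.mem_setOf_eq, h1, h0, and_self]


/-- **Registered sub-goal `stub_oneBondDecomp_k8`** (siege k8): the one-bond decomposition
`μ_w(S) = (1 − w e) · μ_{w[e↦0]}(S) + (w e) · μ_{w[e↦1]}(S)` for `e = s(o, y)`, `o ≠ y`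
(= `goodStep_real_decomp`). [folklore] -/
theorem stub_oneBondDecomp_k8 : ∀ (n : ℕ) (w : Sym2 (Fin n) → unitInterval) (o y : Fin n) (S : Set (BondConfig (Fin n))), o ≠ y → (prodBernoulli w).real S = (1 - (w s(o, y) : ℝ)) * (prodBernoulli (Function.update w s(o, y) 0)).real S + (w s(o, y) : ℝ) * (prodBernoulli (Function.update w s(o, y) 1)).real S :=
  fun _ w _ _ S hoy => goodStep_real_decomp w hoy S

end

end Summit.CriticalPhenomena.PercolationContinuityZ3.Theorems
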